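import Summits.QuantumFields.YangMills.Theorems.FluctuationComparisonRegPrIntLS2BetaTreeGaugeChart
import HarnessLib

/-!
# (C3) THE TUBULAR HAAR CHART OF A TREE GAUGE — SMOOTH EDITION (the transversal `σ` is `C^∞` through the representation)

Crux `stmt-QuantumFields-20520` (`…Theses.UnitScaleTilt.FluctuationComparisonRegPrIntL`), LINE g18-1 S2β LAPLACE, organ (C3).  The landed generic chart
`…S2BetaTreeGaugeChart.exists_tubularChart_of_treeGauge` (p736010) exports `Continuous σ` only; the Peano ∕ Hessian row of the Laplace door
(w4-20520 g15's (L3) «`A ∘ σ` is `C²` at `0`», w5-20520 g13's LIMIT-INST `hS2`) needs the transversal to be DIFFERENTIABLE as a matrix-valued map.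
`exists_tubularChart_of_treeGauge_smooth` = the same theorem, same proof, with ONE MORE ROW: `ContDiff ℝ ⊤ (fun y b => ρ (σ y b))` — bondwise
`σ(y)(b) = const · exp(linear(y)) · const` in the ambient Banach algebra `𝔸` (`IsChartRep.rho_expChart`, `LogChartProduct.expChart_pi_apply`,
`NormedSpace.exp_analytic`).  Statement of p736010 untouched (new name, new file).
[cite: Helgason2000, Ch. I §1 Thm 1.14 (13) p.96; Balaban1985Averaging, (8), (10) p.18; Balaban1985Variational, (19) p.281]
-/

noncomputable section

open MeasureTheory MeasureTheory.Measure Set Function Filter Topology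
open scoped ENNReal
open Literature.MathematicalPhysics.QuantumFieldTheory.Balaban1983to89
open Literature.MathematicalPhysics.QuantumFieldTheory.Balaban1983to89.HaarExponentialChart
open Literature.MathematicalPhysics.QuantumFieldTheory.Balaban1983to89.LogChartProduct
open Literature.Analysis.Asymptotics

namespace Summit.QuantumFields.YangMills.Theorems.FluctuationComparisonRegPrIntLS2BetaTreeGaugeChartSmooth

open Summit.QuantumFields.YangMills.Theorems.FluctuationComparisonRegPrIntLS2BetaTreeGaugeAlgebra
open Summit.QuantumFields.YangMills.Theorems.FluctuationComparisonRegPrIntLS2BetaTreeGaugeHaar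

variable {𝔸 : Type*} [NormedRing 𝔸] [NormedAlgebra ℂ 𝔸] [CompleteSpace 𝔸]
variable {G : Type*} [Group G] [TopologicalSpace G] [IsTopologicalGroup G] [CompactSpace G] [T2Space G]
  [MeasurableSpace G] [BorelSpace G] [SecondCountableTopology G]
variable {C : LogChart 𝔸} {ρ : G →* 𝔸} (h : IsChartRep C ρ) [FiniteDimensional ℝ C.lie]
  (hlie : ∀ x ∈ C.lie, ∀ y ∈ C.lie, x * y - y * x ∈ C.lie)
variable (μG : Measure G) [μG.IsHaarMeasure] [IsProbabilityMeasure μG]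
variable {ι β : Type*} [Fintype ι] [Fintype β]
  (s t : β → ι) (R : Set ι) [DecidablePred (· ∈ R)] (F : Set β) [DecidablePred (· ∈ F)]
  (g : (β → G) → (ι → G))
variable [MeasurableSpace (piLogChart C {x // x ∉ R}).lie] [BorelSpace (piLogChart C {x // x ∉ R}).lie]
variable [MeasurableSpace (piLogChart C {b // b ∉ F}).lie] [BorelSpace (piLogChart C {b // b ∉ F}).lie]
variable {Z : Type*} [NormedAddCommGroup Z] [InnerProductSpace ℝ Z] [FiniteDimensional ℝ Z] [MeasurableSpace Z] [BorelSpace Z]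
  (eZ : Z ≃L[ℝ] (piLogChart C {x // x ∉ R}).lie)
variable {V : Type*} [NormedAddCommGroup V] [InnerProductSpace ℝ V] [FiniteDimensional ℝ V] [MeasurableSpace V] [BorelSpace V]
  (eV : V ≃L[ℝ] (piLogChart C {b // b ∉ F}).lie)

include h hlie eZ eV in
/-- ★★★ **THE TUBULAR HAAR CHART OF A TREE GAUGE** (generic assembly; see the module docstring for the setting and the construction).
[cite: Helgason2000, Ch. I §1 Thm 1.14 (13) p. 96; HasenpflugRudolfSprungk2024, §3.1 Assumption 3 (T); Balaban1985Averaging, (8), (10) p.18;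
Balaban1985Variational, (19) p.281] -/
theorem exists_tubularChart_of_treeGauge_smooth (hgc : Continuous g) (hgR : ∀ V, ∀ r ∈ R, g V r = 1)
    (hcov : ∀ (a : ι → G), (∀ r ∈ R, a r = 1) → ∀ (V : β → G) (x : ι),
      g (fun b => a (s b) * V b * (a (t b))⁻¹) x = g V x * (a x)⁻¹)
    (hkill : ∀ V, ∀ b ∈ F, g V (s b) * V b * (g V (t b))⁻¹ = 1)
    (hloc : ∀ V V' : β → G, (∀ b ∈ F, V b = V' b) → g V = g V') (hg1 : g (fun _ => 1) = fun _ => 1)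
    (U₀ : β → G) :
    ∃ (e : Z → (ι → G)) (σ : V → (β → G)) (W : Set (Z × V)) (J : Z × V → ℝ),
      Continuous e ∧ e 0 = 1 ∧ (∀ z, ∀ r ∈ R, e z r = 1) ∧
      (∀ sZ ∈ 𝓝 (0 : Z), ∃ tt ∈ 𝓝 (1 : ι → G), ∀ w ∈ tt, (∀ r ∈ R, w r = 1) → w ∈ e '' sZ) ∧
      Continuous σ ∧ σ 0 = U₀ ∧ ContDiff ℝ ⊤ (fun y : V => fun b : β => (ρ (σ y b) : 𝔸)) ∧
      IsOpen W ∧ ((0 : Z), (0 : V)) ∈ W ∧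
      InjOn (fun p : Z × V => fun b : β => e p.1 (s b) * σ p.2 b * (e p.1 (t b))⁻¹) W ∧
      (∀ sW ∈ 𝓝 ((0 : Z), (0 : V)), (fun p : Z × V => fun b : β => e p.1 (s b) * σ p.2 b * (e p.1 (t b))⁻¹) '' sW ∈ 𝓝 U₀) ∧
      ContinuousOn J W ∧ (∀ w ∈ W, 0 ≤ J w) ∧ 0 < J (0, 0) ∧
      (Measure.pi fun _ : β => μG).restrict ((fun p : Z × V => fun b : β => e p.1 (s b) * σ p.2 b * (e p.1 (t b))⁻¹) '' W) =
        ((((volume : Measure Z).prod (volume : Measure V)).restrict W).withDensity (fun w => ENNReal.ofReal (J w))).map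
          (fun p : Z × V => fun b : β => e p.1 (s b) * σ p.2 b * (e p.1 (t b))⁻¹) := by
  classical
  haveI := finiteDimensional_piLogChart_lie C {x // x ∉ R}
  haveI := finiteDimensional_piLogChart_lie C {b // b ∉ F}
  -- the two factor groups, their Haar measures and framed exponential charts
  set hR := isChartRep_pi {x // x ∉ R} h with hhR
  set hF := isChartRep_pi {b // b ∉ F} h with hhF
  set νR : Measure ({x // x ∉ R} → G) := Measure.pi fun _ => μG with hνR
  set νF : Measure ({b // b ∉ F} → G) := Measure.pi fun _ => μG with hνF
  obtain ⟨UZ, dZ, hUZo, h0Z, hinjZ, hdZc, hdZ0, hdZpos, -, hchartZ⟩ :=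
    exists_haarChart_expChart_frame hR (lie_adStable_pi C {x // x ∉ R} hlie) νR eZ
  obtain ⟨UV, dV, hUVo, h0V, hinjV, hdVc, hdV0, hdVpos, -, hchartV⟩ :=
    exists_haarChart_expChart_frame hF (lie_adStable_pi C {b // b ∉ F} hlie) νF eV
  set τZ : Z → ({x // x ∉ R} → G) := fun z => hR.expChart (eZ z) with hτZ
  set τV : V → ({b // b ∉ F} → G) := fun y => hF.expChart (eV y) with hτV
  have hτZc : Continuous τZ := hR.continuous_expChart.comp eZ.continuous
  have hτVc : Continuous τV := hF.continuous_expChart.comp eV.continuous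
  have hτZ0 : τZ 0 = 1 := by simp only [hτZ, map_zero, IsChartRep.expChart_zero]
  have hτV0 : τV 0 = 1 := by simp only [hτV, map_zero, IsChartRep.expChart_zero]
  -- the tree-gauge maps
  set Ξ : ({x // x ∉ R} → G) × ({b // b ∉ F} → G) → (β → G) := fun p => fun b : β =>
      (fun x : ι => if hx : x ∈ R then (1 : G) else p.1 ⟨x, hx⟩) (s b) *
        (fun b : β => if hb : b ∈ F then (1 : G) else p.2 ⟨b, hb⟩) b *
        ((fun x : ι => if hx : x ∈ R then (1 : G) else p.1 ⟨x, hx⟩) (t b))⁻¹ with hΞ_def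
  set Ψ : (β → G) → ({x // x ∉ R} → G) × ({b // b ∉ F} → G) := fun V =>
    ((fun x : {x // x ∉ R} => (g V x)⁻¹), (fun b : {b // b ∉ F} => g V (s b) * V b * (g V (t b))⁻¹)) with hΨ_def
  have hΞΨ : ∀ V, Ξ (Ψ V) = V := fun V => xi_psi s t R F g hgR hkill V
  have hΨΞ : ∀ p, Ψ (Ξ p) = p := fun p => psi_xi s t R F g hcov hloc hg1 p.1 p.2
  have hΞc : Continuous Ξ := continuous_xi (G := G) s t R F
  have hΞmp : MeasurePreserving Ξ (νR.prod νF) (Measure.pi fun _ : β => μG) :=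
    measurePreserving_xi μG s t R F g hgc.measurable hgR hcov hkill hloc
  -- `Ξ` is a homeomorphism (continuous bijection, compact → Hausdorff)
  set ΞE : (({x // x ∉ R} → G) × ({b // b ∉ F} → G)) ≃ (β → G) :=
    { toFun := Ξ, invFun := Ψ, left_inv := hΨΞ, right_inv := hΞΨ } with hΞE
  set ΞH : (({x // x ∉ R} → G) × ({b // b ∉ F} → G)) ≃ₜ (β → G) := Continuous.homeoOfEquivCompactToT2 (f := ΞE) hΞc with hΞH
  have hΞH_apply : ∀ p, ΞH p = Ξ p := fun p => rfl
  -- the base point in tree coordinates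
  set w₀ : {x // x ∉ R} → G := (Ψ U₀).1 with hw₀
  set u₀ : {b // b ∉ F} → G := (Ψ U₀).2 with hu₀
  have hq₀ : Ψ U₀ = (w₀, u₀) := rfl
  -- the chart maps
  set ext : ({x // x ∉ R} → G) → (ι → G) := fun w x => if hx : x ∈ R then (1 : G) else w ⟨x, hx⟩ with hext
  have hext_mul : ∀ w w' : {x // x ∉ R} → G, ext (w * w') = ext w * ext w' := by
    intro w w'; funext x; by_cases hx : x ∈ R <;> simp [hext, hx]
  have hext_one : ext 1 = 1 := by funext x; by_cases hx : x ∈ R <;> simp [hext, hx]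
  have hext_R : ∀ w, ∀ r ∈ R, ext w r = 1 := fun w r hr => by simp [hext, hr]
  have hextc : Continuous ext := by
    refine continuous_pi fun x => ?_
    by_cases hx : x ∈ R
    · simp only [hext, dif_pos hx]; exact continuous_const
    · simp only [hext, dif_neg hx]; exact continuous_apply _
  set e : Z → (ι → G) := fun z => ext w₀ * ext (τZ z) * (ext w₀)⁻¹ with he_def
  set σ : V → (β → G) := fun y => Ξ (w₀, u₀ * τV y) with hσ_def
  set Θ' : Z × V → (β → G) := fun p => fun b : β => e p.1 (s b) * σ p.2 b * (e p.1 (t b))⁻¹ with hΘ'_def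
  -- KEY IDENTITY: `Θ' = Ξ ∘ ((w₀,u₀) · ) ∘ (τZ × τV)`
  have hkey : ∀ p : Z × V, Θ' p = Ξ ((w₀, u₀) * (τZ p.1, τV p.2)) := by
    intro p
    funext b
    simp only [hΘ'_def, he_def, hσ_def, hΞ_def, Prod.mk_mul_mk, Pi.mul_apply, Pi.inv_apply, hext]
    by_cases hs : s b ∈ R <;> by_cases ht : t b ∈ R <;> by_cases hb : b ∈ F
    all_goals simp [hs, ht, hb]
    all_goals group
  -- the window and the density
  set W : Set (Z × V) := UZ ×ˢ UV with hW
  set J : Z × V → ℝ := fun p => dZ p.1 * dV p.2 with hJ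
  refine ⟨e, σ, W, J, ?_, ?_, ?_, ?_, ?_, ?_, ?_, hUZo.prod hUVo, ⟨h0Z, h0V⟩, ?_, ?_, ?_, ?_, ?_, ?_⟩
  · -- `e` continuous
    exact ((continuous_const.mul (hextc.comp hτZc)).mul continuous_const)
  · -- `e 0 = 1`
    simp only [he_def, hτZ0, hext_one, mul_one, mul_inv_cancel]
  · -- root-trivial
    intro z r hr
    simp only [he_def, Pi.mul_apply, Pi.inv_apply, hext_R _ r hr, mul_one, mul_inv_cancel]
  · -- `e` is onto a neighbourhood of `1` among the root-trivial transformations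
    intro sZ hsZ
    have h1 : τZ '' sZ ∈ 𝓝 (1 : {x // x ∉ R} → G) :=
      nhds_one_le_map_expChart_frame hR eZ (Filter.image_mem_map hsZ)
    -- conjugate by `w₀` and pull back along the restriction map
    set cj : ({x // x ∉ R} → G) ≃ₜ ({x // x ∉ R} → G) := (Homeomorph.mulLeft w₀).trans (Homeomorph.mulRight w₀⁻¹) with hcj
    have hc1 : cj 1 = 1 := by
      simp only [hcj, Homeomorph.trans_apply, Homeomorph.coe_mulLeft, Homeomorph.coe_mulRight, mul_one, mul_inv_cancel]
    have h2 : cj '' (τZ '' sZ) ∈ 𝓝 (1 : {x // x ∉ R} → G) := by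
      have := cj.isOpenMap.image_mem_nhds h1
      rwa [hc1] at this
    set rest : (ι → G) → ({x // x ∉ R} → G) := fun w x => w x with hrest
    have hrestc : Continuous rest := continuous_pi fun x => continuous_apply _
    have hrest1 : rest 1 = 1 := rfl
    refine ⟨rest ⁻¹' (cj '' (τZ '' sZ)), hrestc.continuousAt.preimage_mem_nhds (by rw [hrest1]; exact h2), ?_⟩
    intro w hw hwR
    obtain ⟨v, ⟨z, hz, rfl⟩, hv⟩ := hw
    refine ⟨z, hz, ?_⟩
    funext x
    by_cases hx : x ∈ R
    · simp only [he_def, Pi.mul_apply, Pi.inv_apply, hext_R _ x hx, mul_one, mul_inv_cancel, hwR x hx]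
    · have hvx := congrFun hv ⟨x, hx⟩
      simp only [hcj, Homeomorph.trans_apply, Homeomorph.coe_mulLeft, Homeomorph.coe_mulRight, hrest] at hvx
      simp only [he_def, Pi.mul_apply, Pi.inv_apply, hext, dif_neg hx]
      simpa using hvx
  · -- `σ` continuous
    exact hΞc.comp (continuous_const.prodMk (continuous_const.mul hτVc))
  · -- `σ 0 = U₀`
    simp only [hσ_def, hτV0, mul_one]
    rw [← hq₀]; exact hΞΨ U₀
  · -- `σ` is smooth through `ρ`: bondwise `const · exp(linear) · const` in `𝔸`
    have hexp : ContDiff ℝ ⊤ (NormedSpace.exp : 𝔸 → 𝔸) :=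
      contDiff_iff_contDiffAt.2 fun x => (NormedSpace.exp_analytic (𝕂 := ℝ) x).contDiffAt
    refine contDiff_pi.2 fun b => ?_
    have hσb : ∀ y : V, ρ (σ y b) = ρ (ext w₀ (s b)) *
        ρ ((fun b : β => if hb : b ∈ F then (1 : G) else (u₀ * τV y) ⟨b, hb⟩) b) * ρ ((ext w₀ (t b))⁻¹) := by
      intro y; simp only [hσ_def, hΞ_def, hext, map_mul]
    rw [show (fun y : V => ρ (σ y b)) = fun y => ρ (ext w₀ (s b)) *
        ρ ((fun b : β => if hb : b ∈ F then (1 : G) else (u₀ * τV y) ⟨b, hb⟩) b) * ρ ((ext w₀ (t b))⁻¹) from funext hσb]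
    refine (contDiff_const.mul ?_).mul contDiff_const
    by_cases hb : b ∈ F
    · simp only [dif_pos hb, map_one]; exact contDiff_const
    · simp only [dif_neg hb, Pi.mul_apply, map_mul]
      refine contDiff_const.mul ?_
      -- `ρ (τV y ⟨b, hb⟩) = exp (a linear function of y)`
      set L : V →ₗ[ℝ] 𝔸 := C.lie.subtype ∘ₗ (LinearMap.proj (R := ℝ) (φ := fun _ : {b // b ∉ F} => C.lie) ⟨b, hb⟩ ∘ₗ
        ((lieEquivPi C {b // b ∉ F}).toLinearMap ∘ₗ (eV : V ≃L[ℝ] (piLogChart C {b // b ∉ F}).lie).toLinearEquiv.toLinearMap)) with hL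
      have hρτ : (fun y : V => ρ (τV y ⟨b, hb⟩)) = fun y => NormedSpace.exp (LinearMap.toContinuousLinearMap L y) := by
        funext y
        show ρ ((isChartRep_pi {b // b ∉ F} h).expChart (eV y) ⟨b, hb⟩) = _
        rw [expChart_pi_apply (B := {b // b ∉ F}) h, h.rho_expChart]
        rfl
      rw [hρτ]
      exact hexp.comp (LinearMap.toContinuousLinearMap L).contDiff
  · -- injectivity on the window
    intro p hp p' hp' hpp
    have h1 : Ξ ((w₀, u₀) * (τZ p.1, τV p.2)) = Ξ ((w₀, u₀) * (τZ p'.1, τV p'.2)) := by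
      rw [← hkey, ← hkey]; exact hpp
    have h2 := mul_left_cancel (ΞE.injective h1)
    simp only [Prod.mk.injEq] at h2
    exact Prod.ext (hinjZ hp.1 hp'.1 h2.1) (hinjV hp.2 hp'.2 h2.2)
  · -- openness at the origin
    intro sW hsW
    have hτ : (fun p : Z × V => (τZ p.1, τV p.2)) '' sW ∈ 𝓝 ((1 : {x // x ∉ R} → G), (1 : {b // b ∉ F} → G)) := by
      have hle : 𝓝 ((1 : {x // x ∉ R} → G), (1 : {b // b ∉ F} → G)) ≤
          map (fun p : Z × V => (τZ p.1, τV p.2)) (𝓝 ((0 : Z), (0 : V))) := by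
        rw [nhds_prod_eq, nhds_prod_eq, ← Filter.prod_map_map_eq]
        exact Filter.prod_mono (nhds_one_le_map_expChart_frame hR eZ) (nhds_one_le_map_expChart_frame hF eV)
      exact hle (Filter.image_mem_map hsW)
    have hL : (fun q => (w₀, u₀) * q) '' ((fun p : Z × V => (τZ p.1, τV p.2)) '' sW) ∈ 𝓝 ((w₀, u₀) : ({x // x ∉ R} → G) × ({b // b ∉ F} → G)) := by
      have := (Homeomorph.mulLeft ((w₀, u₀) : ({x // x ∉ R} → G) × ({b // b ∉ F} → G))).isOpenMap.image_mem_nhds hτ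
      simpa using this
    have hΞo : Ξ '' ((fun q => (w₀, u₀) * q) '' ((fun p : Z × V => (τZ p.1, τV p.2)) '' sW)) ∈ 𝓝 (Ξ (w₀, u₀)) := by
      have := ΞH.isOpenMap.image_mem_nhds hL
      simpa [hΞH_apply] using this
    have hU₀ : Ξ (w₀, u₀) = U₀ := by rw [← hq₀]; exact hΞΨ U₀
    rw [hU₀] at hΞo
    refine Filter.mem_of_superset hΞo ?_
    rintro _ ⟨_, ⟨_, ⟨p, hp, rfl⟩, rfl⟩, rfl⟩
    exact ⟨p, hp, hkey p⟩
  · -- `J` continuous on `W`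
    exact ((hdZc.comp continuous_fst).mul (hdVc.comp continuous_snd)).continuousOn
  · exact fun w _ => mul_nonneg (hdZ0 _) (hdV0 _)
  · exact mul_pos hdZpos hdVpos
  · -- THE CHART IDENTITY
    haveI : (νR.prod νF).IsMulLeftInvariant := inferInstance
    -- (1) the product of the two frame charts
    have hτm : Measurable (fun p : Z × V => (τZ p.1, τV p.2)) := (hτZc.prodMap hτVc).measurable
    have hdZm : Measurable fun z => ENNReal.ofReal (dZ z) := ENNReal.measurable_ofReal.comp hdZc.measurable
    have hdVm : Measurable fun y => ENNReal.ofReal (dV y) := ENNReal.measurable_ofReal.comp hdVc.measurable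
    have hprod : (νR.prod νF).restrict ((fun p : Z × V => (τZ p.1, τV p.2)) '' W) =
        ((((volume : Measure Z).prod (volume : Measure V)).restrict W).withDensity (fun w => ENNReal.ofReal (J w))).map
          (fun p : Z × V => (τZ p.1, τV p.2)) := by
      have himg : (fun p : Z × V => (τZ p.1, τV p.2)) '' W = (τZ '' UZ) ×ˢ (τV '' UV) := by
        rw [hW]; exact Set.prodMap_image_prod τZ τV UZ UV
      rw [himg, ← Measure.prod_restrict, hchartZ, hchartV,
        Measure.map_prod_map _ _ hτZc.measurable hτVc.measurable,
        prod_withDensity hdZm hdVm, Measure.prod_restrict, ← hW]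
      congr 1
      refine withDensity_congr_ae (Filter.Eventually.of_forall fun p => ?_)
      simp only [hJ]
      rw [ENNReal.ofReal_mul (hdZ0 _)]
    -- (2) left translation in the product group is Haar-preserving and a measurable embedding
    have hLmp : MeasurePreserving (fun q => ((w₀, u₀) : ({x // x ∉ R} → G) × ({b // b ∉ F} → G)) * q) (νR.prod νF) (νR.prod νF) :=
      measurePreserving_mul_left _ _
    have hLemb : MeasurableEmbedding (fun q => ((w₀, u₀) : ({x // x ∉ R} → G) × ({b // b ∉ F} → G)) * q) :=
      (Homeomorph.mulLeft ((w₀, u₀) : ({x // x ∉ R} → G) × ({b // b ∉ F} → G))).measurableEmbedding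
    have hL := (hLmp.restrict_image_emb hLemb ((fun p : Z × V => (τZ p.1, τV p.2)) '' W)).map_eq
    -- (3) `Ξ` is measure preserving and a measurable embedding (homeomorphism)
    have hΞemb : MeasurableEmbedding Ξ := by
      have hco : (ΞH : (({x // x ∉ R} → G) × ({b // b ∉ F} → G)) → (β → G)) = Ξ := funext hΞH_apply
      rw [← hco]
      exact ΞH.measurableEmbedding
    have hX := (hΞmp.restrict_image_emb hΞemb
      ((fun q => ((w₀, u₀) : ({x // x ∉ R} → G) × ({b // b ∉ F} → G)) * q) '' ((fun p : Z × V => (τZ p.1, τV p.2)) '' W))).map_eq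
    -- assemble
    have hΘ'eq : Θ' = Ξ ∘ (fun q => ((w₀, u₀) : ({x // x ∉ R} → G) × ({b // b ∉ F} → G)) * q) ∘ (fun p : Z × V => (τZ p.1, τV p.2)) := by
      funext p; exact hkey p
    have himg3 : Θ' '' W = Ξ '' ((fun q => ((w₀, u₀) : ({x // x ∉ R} → G) × ({b // b ∉ F} → G)) * q) '' ((fun p : Z × V => (τZ p.1, τV p.2)) '' W)) := by
      rw [hΘ'eq, Set.image_comp, Set.image_comp]
    show (Measure.pi fun _ : β => μG).restrict (Θ' '' W) =
      ((((volume : Measure Z).prod (volume : Measure V)).restrict W).withDensity (fun w => ENNReal.ofReal (J w))).map Θ'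
    rw [himg3, ← hX, ← hL, hprod, Measure.map_map hLemb.measurable hτm, Measure.map_map hΞemb.measurable (hLemb.measurable.comp hτm), hΘ'eq]

end Summit.QuantumFields.YangMills.Theorems.FluctuationComparisonRegPrIntLS2BetaTreeGaugeChartSmooth

end
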